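import Summits.KontsevichZagierPeriods.Zeta5Search.TwoTaleOmega.StepAR
import Summits.KontsevichZagierPeriods.Zeta5Search.TwoTaleOmega.OmegaBridge

/-!
# (bmiss)@Ω — the recurrence in direction `a` for the sign-free forms `U1`, `U0`, for `g ≥ b + 4` (cell `pub-zeta5`, cert-1 gen 4)

HONEST FRAMING: systematic search; recurrence certificates; no irrationality claim unless certified. Pure finite algebra
over `ℚ`; no named fact, no `sorry`.

Direction `δ = a = (1,0,0,0,0)`: `rec_a` combines `StepAL.recL_a` and `StepAR.recR_a` into
`Σ_{k<4} c^a_k(p)·U1/U0(p+kδ_a) = 0` for `p, …, p+3δ_a ∈ Ω` with **`g ≥ b+4`** (the second-tale legitimacy hypothesis; see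
`StepAR`), and the plug-in `hstepA_U1/U0` = the `δ = dirA` case of the hypotheses `hL/hR` of cert-2's
`TwoTaleOmegaAefTable.eq_on_Omega_all` for every legitimacy predicate with `Legit dirA p₀ → p₀.b + 4 ≤ p₀.g`. (`c^a_3 ≠ 0` is
cert-2's `hA`/rule-domain business and is not needed for `hL/hR`.)
-/

noncomputable section

open Finset Polynomial
open Literature.NumberTheory.Irrationality.Zudilin2014
open Summit.KontsevichZagierPeriods.Zeta5Search.FormalBarnes
open Summit.KontsevichZagierPeriods.Zeta5Search.Certificates.TwoTaleTelescope

namespace Summit.KontsevichZagierPeriods.Zeta5Search.TwoTaleOmega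

namespace Pt

variable {p : Pt}

/-- The first-tale truncation of `U0` may be raised to the common `d⁺(p) + 10` along `δ_a` (`d` decreases). -/
theorem lam0_dExp_eq_a {k : ℤ} (hk : (p.addA k).Omega) (hk0 : 0 ≤ k) (s : ℤ) :
    lam0 (dExp (p.addA k).t1a (p.addA k).t1b) s (p.addA k).vL = lam0 (dExp p.t1a p.t1b + 10) s (p.addA k).vL := by
  refine (lam0_eq_of_le s _ (vL_natDegree_le_w hk) ?_).symm
  unfold dExp
  rw [sum_t1a_sub_sum_t1b, sum_t1a_sub_sum_t1b, dInt_addA]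
  omega

/-- **The `a`-recurrence of the sign-free forms (for `g ≥ b+4`).** For `p, p+δ_a, p+2δ_a, p+3δ_a ∈ Ω` with `g ≥ b + 4`:
`Σ_k c^a_k(p)·U1(p+kδ_a) = 0` and `Σ_k c^a_k(p)·U0(p+kδ_a) = 0`. -/
theorem rec_a (h0 : p.Omega) (h1 : (p.addA 1).Omega) (h2 : (p.addA 2).Omega) (h3 : (p.addA 3).Omega)
    (hgb : p.b + 4 ≤ p.g) :
    (p.coefA 0 * p.U1 + p.coefA 1 * (p.addA 1).U1 + p.coefA 2 * (p.addA 2).U1 + p.coefA 3 * (p.addA 3).U1 = 0) ∧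
    (p.coefA 0 * p.U0 + p.coefA 1 * (p.addA 1).U0 + p.coefA 2 * (p.addA 2).U0 + p.coefA 3 * (p.addA 3).U0 = 0) := by
  have hL := recL_a h0 h1 h2 h3
  have hR := recR_a h0 h1 h2 h3 hgb
  have e0 : lam0 (dExp p.t1a p.t1b) p.nodeL p.vL = lam0 (dExp p.t1a p.t1b + 10) p.nodeL p.vL :=
    (lam0_eq_of_le _ _ (vL_natDegree_le_w h0) (by omega)).symm
  have e1 := lam0_dExp_eq_a h1 (by norm_num) (p.addA 1).nodeL
  have e2 := lam0_dExp_eq_a h2 (by norm_num) (p.addA 2).nodeL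
  have e3 := lam0_dExp_eq_a h3 (by norm_num) (p.addA 3).nodeL
  unfold U1 U0
  rw [e0, e1, e2, e3]
  constructor
  · linear_combination hL.1 + (1 / 4 : ℚ) * hR.1
  · linear_combination hL.2 + (1 / 2 : ℚ) * hR.2

/-- **The `a`-step of the Ω-induction** (for `g ≥ b+4`, with `c^a_3(p) ≠ 0` supplied by the rule domain): if `U1`, `U0` vanish at
`p, p+δ_a, p+2δ_a`, they vanish at `p+3δ_a`. -/
theorem step_a (h0 : p.Omega) (h1 : (p.addA 1).Omega) (h2 : (p.addA 2).Omega) (h3 : (p.addA 3).Omega)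
    (hgb : p.b + 4 ≤ p.g) (hc : p.coefA 3 ≠ 0)
    (u0 : p.U1 = 0 ∧ p.U0 = 0) (u1 : (p.addA 1).U1 = 0 ∧ (p.addA 1).U0 = 0)
    (u2 : (p.addA 2).U1 = 0 ∧ (p.addA 2).U0 = 0) : (p.addA 3).U1 = 0 ∧ (p.addA 3).U0 = 0 := by
  have h := rec_a h0 h1 h2 h3 hgb
  rw [u0.1, u1.1, u2.1, u0.2, u1.2, u2.2] at h
  simp only [mul_zero, zero_add] at h
  exact ⟨(mul_eq_zero.1 h.1).resolve_left hc, (mul_eq_zero.1 h.2).resolve_left hc⟩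

end Pt

/-! ### The `δ = dirA` case of cert-2's step hypotheses `hL`/`hR`, for legitimacy predicates forcing `g ≥ b + 4` -/

/-- **Plug-in form for cert-2's Ω-induction, `U1`, direction `a`** (any `aef` table; any legitimacy predicate with
`Legit dirA p₀ → p₀.b + 4 ≤ p₀.g`). -/
theorem hstepA_U1 (cAEF : Certificates.TwoTaleTelescope.Pt → ℕ → ℤ) (Legit : Certificates.TwoTaleTelescope.Pt →
    Certificates.TwoTaleTelescope.Pt → Prop) (hLeg : ∀ p₀, Legit dirA p₀ → p₀ 1 + 4 ≤ p₀ 4)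
    (p₀ : Certificates.TwoTaleTelescope.Pt) (h : p₀ ∈ StepBase Legit dirA) :
    ∑ k ∈ range 4, (coef cAEF dirA p₀ k : ℚ) * (ofVec (p₀ + (k : ℤ) • dirA)).U1 = 0 := by
  have hΩ := h.2.1
  have hgb : (ofVec p₀).b + 4 ≤ (ofVec p₀).g := by simpa using hLeg p₀ h.2.2
  have h0 : (ofVec p₀).Omega := by have := Omega_ofVec (hΩ 0 (by norm_num)); simpa using this
  have h1 : ((ofVec p₀).addA 1).Omega := by rw [← ofVec_add_dirA]; exact Omega_ofVec (by simpa using hΩ 1 (by norm_num))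
  have h2 : ((ofVec p₀).addA 2).Omega := by rw [← ofVec_add_dirA]; exact Omega_ofVec (by simpa using hΩ 2 (by norm_num))
  have h3 : ((ofVec p₀).addA 3).Omega := by rw [← ofVec_add_dirA]; exact Omega_ofVec (by simpa using hΩ 3 (by norm_num))
  have r := (Pt.rec_a h0 h1 h2 h3 hgb).1
  rw [sum_range_succ, sum_range_succ, sum_range_succ, sum_range_one]
  push_cast
  rw [zero_smul, add_zero, ofVec_add_dirA, ofVec_add_dirA, ofVec_add_dirA]
  simp only [coef_A, tabAt_cast, tabA]
  simpa [Pt.coefA] using r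

/-- **Plug-in form for cert-2's Ω-induction, `U0`, direction `a`** (same hypotheses). -/
theorem hstepA_U0 (cAEF : Certificates.TwoTaleTelescope.Pt → ℕ → ℤ) (Legit : Certificates.TwoTaleTelescope.Pt →
    Certificates.TwoTaleTelescope.Pt → Prop) (hLeg : ∀ p₀, Legit dirA p₀ → p₀ 1 + 4 ≤ p₀ 4)
    (p₀ : Certificates.TwoTaleTelescope.Pt) (h : p₀ ∈ StepBase Legit dirA) :
    ∑ k ∈ range 4, (coef cAEF dirA p₀ k : ℚ) * (ofVec (p₀ + (k : ℤ) • dirA)).U0 = 0 := by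
  have hΩ := h.2.1
  have hgb : (ofVec p₀).b + 4 ≤ (ofVec p₀).g := by simpa using hLeg p₀ h.2.2
  have h0 : (ofVec p₀).Omega := by have := Omega_ofVec (hΩ 0 (by norm_num)); simpa using this
  have h1 : ((ofVec p₀).addA 1).Omega := by rw [← ofVec_add_dirA]; exact Omega_ofVec (by simpa using hΩ 1 (by norm_num))
  have h2 : ((ofVec p₀).addA 2).Omega := by rw [← ofVec_add_dirA]; exact Omega_ofVec (by simpa using hΩ 2 (by norm_num))
  have h3 : ((ofVec p₀).addA 3).Omega := by rw [← ofVec_add_dirA]; exact Omega_ofVec (by simpa using hΩ 3 (by norm_num))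
  have r := (Pt.rec_a h0 h1 h2 h3 hgb).2
  rw [sum_range_succ, sum_range_succ, sum_range_succ, sum_range_one]
  push_cast
  rw [zero_smul, add_zero, ofVec_add_dirA, ofVec_add_dirA, ofVec_add_dirA]
  simp only [coef_A, tabAt_cast, tabA]
  simpa [Pt.coefA] using r

end Summit.KontsevichZagierPeriods.Zeta5Search.TwoTaleOmega

end
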